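import Literature.NumberTheory.LFunctions.ConnesProlateGuessTurning
import HarnessLib

/-!
# Window comparison of prolate functions with Hermite functions (Gronwall)

THIS IS NOT AN RH STATEMENT. Step 3a of an RH-free proof attempt of Connes' Fact 6.4
(`prolateGuess_tendsto_riemannXi`): on a fixed window `[0, X]` (`2X + 2 ≤ λ`) a prolate function
`f` (`IsProlateFunction lam n f`, eigenvalue `χ` with `0 ≤ χ ≤ (μ+1)λ²`) is compared with the
solution `h` of the Hermite equation `h'' = (4π²x² − μ) h`, `h(0) > 0`, `h′(0) = 0`:

* `hasDerivAt_deriv`: the prolate equation solved for `f''` on `(−λ, λ)`;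
* `window_apriori`: `|f|, |f′| ≤ f(0)·e^{KX}` on `[0, X]`, `K = 4(4π²X² + μ + 2)` (Gronwall);
* `window_compare`: `|f − (f(0)/h(0)) h|, |f′ − (f(0)/h(0)) h′| ≤ f(0)·η` on `[0, X]` with
  `η = 2e^{2KX}(δ + (2X + 4π²X⁴ + μX²)/λ²)` whenever `|χ − μλ²| ≤ δλ²` (Gronwall for the defect
  `f'' − (4π²x² − μ)f = (2xf′ + (μλ² − χ + 4π²x⁴ − μx²)f)/(λ² − x²)`);
* `tail_bounds`: past the window (`χ ≤ (μ + δ)λ² < 4π²X²λ²`) the turning-point estimates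
  of `ConnesProlateGuessTurning` give `λ|f(λ)|`, `∫_X^λ |f|`, `∫_X^λ f²`, `∫_X^λ |f′|(1+x)` in terms
  of `|f(X)|`, `|f′(X)|` and `D = 4π²X² − μ − δ`;
* `core_scale`, `core_outputs`: with `∫_{−λ}^{λ} f² = 1` the scale `c = f(0)/h(0)` is pinned to `1`
  (`∫_0^∞ h² = 1/2`) and the three quantities `λ|f(λ)|`, `∫_0^λ |f − h|`, `∫_0^λ |f′ − h′|(1+x)` are
  `O(ω)`;
* `uniform_limits`: **if the eigenvalues are pinned (`χ/λ² → μ` uniformly, proved for `n = 0, 4`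
  in `ConnesProlateGuessSturm`) then, uniformly over the prolate functions with `n` zeros,
  `λ|f(λ)| → 0`, `∫_0^λ |f − h| → 0`, `∫_0^λ |f′ − h′|(1+x) → 0`** — the inputs (E), (W) of
  `prolateGuess_tendsto_riemannXi_of_deriv_tendsto`, from the `IsProlateFunction` interface alone.

[cite: SlepianPollak1961, §III; Connes2026Letter, §6.3 (arXiv:2602.04022); folklore (Gronwall)]
-/

noncomputable section

open Real Set MeasureTheory Filter Topology intervalIntegral

namespace Literature.NumberTheory.LFunctions

namespace IsProlateFunction

variable {lam : ℝ} {n : ℕ} {f : ℝ → ℝ}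

/-- The prolate equation solved for `f''`: on `(−λ, λ)`,
`f'' = (2x f′ + ((2πλx)² − χ) f)/(λ² − x²)`. [folklore] -/
theorem hasDerivAt_deriv (hf : IsProlateFunction lam n f) {χ : ℝ}
    (hχ : ∀ x ∈ Ioo (-lam) lam,
      -(deriv (fun y ↦ (lam ^ 2 - y ^ 2) * deriv f y) x) + (2 * π * lam * x) ^ 2 * f x = χ * f x)
    {x : ℝ} (hx : x ∈ Ioo (-lam) lam) :
    HasDerivAt (deriv f)
      ((2 * x * deriv f x + ((2 * π * lam * x) ^ 2 - χ) * f x) / (lam ^ 2 - x ^ 2)) x := by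
  have hP := hf.hasDerivAt_sqMulDeriv hχ hx
  have hpos : 0 < lam ^ 2 - x ^ 2 := by nlinarith [hx.1, hx.2]
  have hD : HasDerivAt (fun y : ℝ ↦ lam ^ 2 - y ^ 2) (-(2 * x)) x := by
    have h := (hasDerivAt_pow 2 x).const_sub (lam ^ 2)
    simpa using h
  have hq := hP.div hD hpos.ne'
  have heq : (fun y ↦ (lam ^ 2 - y ^ 2) * deriv f y / (lam ^ 2 - y ^ 2)) =ᶠ[𝓝 x] deriv f := by
    filter_upwards [Ioo_mem_nhds hx.1 hx.2] with y hy
    have : 0 < lam ^ 2 - y ^ 2 := by nlinarith [hy.1, hy.2]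
    field_simp
  refine (hq.congr_of_eventuallyEq heq.symm).congr_deriv ?_
  field_simp
  ring

/-- **A-priori window bound** (Gronwall): for `2X + 2 ≤ λ`, `0 ≤ χ ≤ (μ + 1)λ²`, on `[0, X]`
`|f|, |f′| ≤ f(0) · e^{KX}` with `K = 4(4π²X² + μ + 2)`. [folklore] -/
theorem window_apriori (hf : IsProlateFunction lam n f) {χ : ℝ}
    (hχ : ∀ x ∈ Ioo (-lam) lam,
      -(deriv (fun y ↦ (lam ^ 2 - y ^ 2) * deriv f y) x) + (2 * π * lam * x) ^ 2 * f x = χ * f x)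
    {X μ : ℝ} (hX : 0 ≤ X) (hμ : 0 ≤ μ) (hl : 2 * X + 2 ≤ lam) (hχ0 : 0 ≤ χ)
    (hχu : χ ≤ (μ + 1) * lam ^ 2) {x : ℝ} (hx : x ∈ Icc 0 X) :
    |f x| ≤ f 0 * Real.exp (4 * (4 * π ^ 2 * X ^ 2 + μ + 2) * X) ∧
      |deriv f x| ≤ f 0 * Real.exp (4 * (4 * π ^ 2 * X ^ 2 + μ + 2) * X) := by
  have hlam := hf.lam_pos
  have hl2 : 0 < lam ^ 2 := by positivity
  set K : ℝ := 4 * (4 * π ^ 2 * X ^ 2 + μ + 2) with hK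
  have hK1 : 1 ≤ K := by rw [hK]; nlinarith [sq_nonneg (π * X)]
  have hsub : Icc 0 X ⊆ Ioo (-lam) lam := fun y hy ↦ ⟨by linarith [hy.1], by linarith [hy.2]⟩
  set v : ℝ → ℝ × ℝ := fun y ↦ (f y, deriv f y) with hv
  have hcont : ContinuousOn v (Icc 0 X) :=
    ((hf.contDiffOn.continuousOn.mono (Icc_subset_Icc (by linarith) (by linarith))).prodMk
      (hf.continuousOn_deriv.mono hsub))
  have hder : ∀ y ∈ Ico 0 X, HasDerivWithinAt v
      (deriv f y, (2 * y * deriv f y + ((2 * π * lam * y) ^ 2 - χ) * f y) / (lam ^ 2 - y ^ 2))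
      (Ici y) y := by
    intro y hy
    have hy' : y ∈ Ioo (-lam) lam := hsub ⟨hy.1, hy.2.le⟩
    exact ((hf.differentiableAt hy').hasDerivAt.prodMk (hf.hasDerivAt_deriv hχ hy')).hasDerivWithinAt
  have h0 : ‖v 0‖ ≤ f 0 := by
    simp only [hv, hf.deriv_zero, Prod.norm_mk, Real.norm_eq_abs, abs_zero, abs_of_pos hf.pos_zero]
    exact max_le le_rfl hf.pos_zero.le
  have hbound : ∀ y ∈ Ico 0 X,
      ‖(deriv f y, (2 * y * deriv f y + ((2 * π * lam * y) ^ 2 - χ) * f y) / (lam ^ 2 - y ^ 2))‖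
        ≤ K * ‖v y‖ + 0 := by
    intro y hy
    rw [add_zero, Prod.norm_mk, Real.norm_eq_abs, Real.norm_eq_abs]
    have hm1 : |f y| ≤ ‖v y‖ := by
      rw [hv, Prod.norm_mk, Real.norm_eq_abs, Real.norm_eq_abs]; exact le_max_left _ _
    have hm2 : |deriv f y| ≤ ‖v y‖ := by
      rw [hv, Prod.norm_mk, Real.norm_eq_abs, Real.norm_eq_abs]; exact le_max_right _ _
    have hm0 : 0 ≤ ‖v y‖ := norm_nonneg _
    have hKv : ‖v y‖ ≤ K * ‖v y‖ := by
      have := mul_le_mul_of_nonneg_right hK1 hm0; linarith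
    refine max_le (by linarith) ?_
    have hden : 3 / 4 * lam ^ 2 ≤ lam ^ 2 - y ^ 2 := by nlinarith [hy.1, hy.2]
    have hdenpos : 0 < lam ^ 2 - y ^ 2 := by linarith
    rw [abs_div, abs_of_pos hdenpos, div_le_iff₀ hdenpos]
    have hnum : |2 * y * deriv f y + ((2 * π * lam * y) ^ 2 - χ) * f y|
        ≤ 2 * X * ‖v y‖ + (4 * π ^ 2 * X ^ 2 * lam ^ 2 + (μ + 1) * lam ^ 2) * ‖v y‖ := by
      have h1 : |2 * y * deriv f y| ≤ 2 * X * ‖v y‖ := by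
        rw [abs_mul, abs_of_nonneg (by linarith [hy.1])]
        exact mul_le_mul (by linarith [hy.2]) hm2 (abs_nonneg _) (by linarith [hy.1])
      have h2 : |((2 * π * lam * y) ^ 2 - χ) * f y|
          ≤ (4 * π ^ 2 * X ^ 2 * lam ^ 2 + (μ + 1) * lam ^ 2) * ‖v y‖ := by
        rw [abs_mul]
        refine mul_le_mul ?_ hm1 (abs_nonneg _) (by positivity)
        have hy2 : (2 * π * lam * y) ^ 2 ≤ 4 * π ^ 2 * X ^ 2 * lam ^ 2 := by
          have : (2 * π * lam * y) ^ 2 ≤ (2 * π * lam * X) ^ 2 :=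
            pow_le_pow_left₀ (by have := hy.1; positivity)
              (mul_le_mul_of_nonneg_left hy.2.le (by positivity)) 2
          linarith [show (2 * π * lam * X) ^ 2 = 4 * π ^ 2 * X ^ 2 * lam ^ 2 by ring]
        calc |(2 * π * lam * y) ^ 2 - χ| ≤ |(2 * π * lam * y) ^ 2| + |χ| := abs_sub _ _
          _ ≤ _ := by rw [abs_of_nonneg (sq_nonneg _), abs_of_nonneg hχ0]; linarith
      exact (abs_add_le _ _).trans (by linarith)
    have hX2 : 2 * X ≤ lam ^ 2 := by nlinarith
    have hfin : 2 * X * ‖v y‖ + (4 * π ^ 2 * X ^ 2 * lam ^ 2 + (μ + 1) * lam ^ 2) * ‖v y‖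
        ≤ K * ‖v y‖ * (3 / 4 * lam ^ 2) := by
      rw [hK]
      have := mul_le_mul_of_nonneg_right hX2 hm0
      nlinarith [mul_nonneg hm0 hl2.le, mul_nonneg (mul_nonneg hm0 hl2.le) (sq_nonneg (π * X)),
        mul_nonneg (mul_nonneg hm0 hl2.le) hμ]
    calc |2 * y * deriv f y + ((2 * π * lam * y) ^ 2 - χ) * f y|
        ≤ K * ‖v y‖ * (3 / 4 * lam ^ 2) := hnum.trans hfin
      _ ≤ K * ‖v y‖ * (lam ^ 2 - y ^ 2) :=
          mul_le_mul_of_nonneg_left hden (by positivity)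
  have hG := norm_le_gronwallBound_of_norm_deriv_right_le hcont hder h0 hbound x hx
  rw [gronwallBound_ε0, sub_zero] at hG
  have hexp : f 0 * Real.exp (K * x) ≤ f 0 * Real.exp (K * X) :=
    mul_le_mul_of_nonneg_left (Real.exp_le_exp.2 (by nlinarith [hx.2])) hf.pos_zero.le
  rw [hv, Prod.norm_mk, Real.norm_eq_abs, Real.norm_eq_abs] at hG
  exact ⟨(le_max_left _ _).trans (hG.trans hexp), (le_max_right _ _).trans (hG.trans hexp)⟩

/-- Pure algebra for the defect of the prolate equation against the Hermite equation. [folklore] -/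
theorem defect_identity {lam x χ μ F F' : ℝ} (hden : lam ^ 2 - x ^ 2 ≠ 0) :
    (2 * x * F' + ((2 * π * lam * x) ^ 2 - χ) * F) / (lam ^ 2 - x ^ 2) - (4 * π ^ 2 * x ^ 2 - μ) * F
      = (2 * x * F' + (μ * lam ^ 2 - χ + 4 * π ^ 2 * x ^ 4 - μ * x ^ 2) * F) / (lam ^ 2 - x ^ 2) := by
  field_simp
  ring

set_option maxHeartbeats 800000 in
/-- **Window comparison** (Gronwall on the defect): for `2X + 2 ≤ λ`, `0 ≤ χ`, `|χ − μλ²| ≤ δλ²`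
(`0 ≤ δ ≤ 1`) and `h` solving `h'' = (4π²x² − μ)h` with `h(0) > 0`, `h′(0) = 0`, on `[0, X]`
`|f − (f(0)/h(0))h|, |f′ − (f(0)/h(0))h′| ≤ f(0)·η`, `η = 2e^{2KX}(δ + (2X + 4π²X⁴ + μX²)/λ²)`,
`K = 4(4π²X² + μ + 2)`. [folklore] -/
theorem window_compare (hf : IsProlateFunction lam n f) {χ : ℝ}
    (hχ : ∀ x ∈ Ioo (-lam) lam,
      -(deriv (fun y ↦ (lam ^ 2 - y ^ 2) * deriv f y) x) + (2 * π * lam * x) ^ 2 * f x = χ * f x)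
    {X μ δ : ℝ} (hX : 0 ≤ X) (hμ : 0 ≤ μ) (hδ0 : 0 ≤ δ) (hδ1 : δ ≤ 1) (hl : 2 * X + 2 ≤ lam)
    (hχ0 : 0 ≤ χ) (hχδ : |χ - μ * lam ^ 2| ≤ δ * lam ^ 2)
    {h h' : ℝ → ℝ} (hh : ∀ x, HasDerivAt h (h' x) x)
    (hh' : ∀ x, HasDerivAt h' ((4 * π ^ 2 * x ^ 2 - μ) * h x) x)
    (hh0 : 0 < h 0) (hh'0 : h' 0 = 0) {x : ℝ} (hx : x ∈ Icc 0 X) :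
    |f x - f 0 / h 0 * h x| ≤ f 0 * (2 * Real.exp (8 * (4 * π ^ 2 * X ^ 2 + μ + 2) * X) *
        (δ + (2 * X + 4 * π ^ 2 * X ^ 4 + μ * X ^ 2) / lam ^ 2)) ∧
      |deriv f x - f 0 / h 0 * h' x| ≤ f 0 * (2 * Real.exp (8 * (4 * π ^ 2 * X ^ 2 + μ + 2) * X) *
        (δ + (2 * X + 4 * π ^ 2 * X ^ 4 + μ * X ^ 2) / lam ^ 2)) := by
  have hlam := hf.lam_pos
  have hl2 : 0 < lam ^ 2 := by positivity
  have hf0 := hf.pos_zero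
  set K : ℝ := 4 * (4 * π ^ 2 * X ^ 2 + μ + 2) with hK
  have hK1 : 1 ≤ K := by rw [hK]; nlinarith [sq_nonneg (π * X)]
  have hKpos : 0 < K := by linarith
  set Cx : ℝ := 2 * X + 4 * π ^ 2 * X ^ 4 + μ * X ^ 2 with hCx
  have hCx0 : 0 ≤ Cx := by rw [hCx]; positivity
  have hχu : χ ≤ (μ + 1) * lam ^ 2 := by
    have := (abs_le.1 hχδ).2; nlinarith
  -- a-priori bound on the window
  set B : ℝ := f 0 * Real.exp (K * X) with hB
  have hB0 : 0 ≤ B := by positivity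
  have hapr : ∀ y ∈ Icc 0 X, |f y| ≤ B ∧ |deriv f y| ≤ B := fun y hy ↦
    hf.window_apriori hχ hX hμ hl hχ0 hχu hy
  set εr : ℝ := 2 * B * (δ + Cx / lam ^ 2) with hεr
  have hεr0 : 0 ≤ εr := by positivity
  have hsub : Icc 0 X ⊆ Ioo (-lam) lam := fun y hy ↦ ⟨by linarith [hy.1], by linarith [hy.2]⟩
  set c : ℝ := f 0 / h 0 with hc
  -- the defect bound
  have hdef : ∀ y ∈ Ico 0 X,
      |(2 * y * deriv f y + ((2 * π * lam * y) ^ 2 - χ) * f y) / (lam ^ 2 - y ^ 2)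
        - (4 * π ^ 2 * y ^ 2 - μ) * f y| ≤ εr := by
    intro y hy
    have hden : 3 / 4 * lam ^ 2 ≤ lam ^ 2 - y ^ 2 := by nlinarith [hy.1, hy.2]
    have hdenpos : 0 < lam ^ 2 - y ^ 2 := by linarith
    rw [defect_identity hdenpos.ne', abs_div, abs_of_pos hdenpos, div_le_iff₀ hdenpos]
    obtain ⟨hfy, hf'y⟩ := hapr y ⟨hy.1, hy.2.le⟩
    have h1 : |2 * y * deriv f y| ≤ 2 * X * B := by
      rw [abs_mul, abs_of_nonneg (by linarith [hy.1])]
      exact mul_le_mul (by linarith [hy.2]) hf'y (abs_nonneg _) (by linarith [hy.1])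
    have hy4 : y ^ 4 ≤ X ^ 4 := pow_le_pow_left₀ hy.1 hy.2.le 4
    have hy2 : y ^ 2 ≤ X ^ 2 := pow_le_pow_left₀ hy.1 hy.2.le 2
    have h2 : |(μ * lam ^ 2 - χ + 4 * π ^ 2 * y ^ 4 - μ * y ^ 2) * f y|
        ≤ (δ * lam ^ 2 + 4 * π ^ 2 * X ^ 4 + μ * X ^ 2) * B := by
      rw [abs_mul]
      refine mul_le_mul ?_ hfy (abs_nonneg _) (by positivity)
      have hμχ : |μ * lam ^ 2 - χ| ≤ δ * lam ^ 2 := by rw [abs_sub_comm]; exact hχδ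
      calc |μ * lam ^ 2 - χ + 4 * π ^ 2 * y ^ 4 - μ * y ^ 2|
          ≤ |μ * lam ^ 2 - χ + 4 * π ^ 2 * y ^ 4| + |μ * y ^ 2| := abs_sub _ _
        _ ≤ |μ * lam ^ 2 - χ| + |4 * π ^ 2 * y ^ 4| + |μ * y ^ 2| := by
            linarith [abs_add_le (μ * lam ^ 2 - χ) (4 * π ^ 2 * y ^ 4)]
        _ ≤ δ * lam ^ 2 + 4 * π ^ 2 * X ^ 4 + μ * X ^ 2 := by
            rw [abs_of_nonneg (by positivity : (0:ℝ) ≤ 4 * π ^ 2 * y ^ 4),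
              abs_of_nonneg (by positivity : (0:ℝ) ≤ μ * y ^ 2)]
            nlinarith [sq_nonneg π]
    have hX2 : 2 * X ≤ lam ^ 2 := by nlinarith
    have hsum : 2 * X * B + (δ * lam ^ 2 + 4 * π ^ 2 * X ^ 4 + μ * X ^ 2) * B
        ≤ εr * (3 / 4 * lam ^ 2) := by
      rw [hεr]
      have e : 2 * B * (δ + Cx / lam ^ 2) * (3 / 4 * lam ^ 2)
          = 3 / 2 * B * (δ * lam ^ 2 + Cx) := by field_simp; ring
      rw [e, hCx]
      have a1 : 0 ≤ X * B := mul_nonneg hX hB0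
      have a2 : 0 ≤ δ * lam ^ 2 * B := by positivity
      have a3 : 0 ≤ π ^ 2 * X ^ 4 * B := by positivity
      have a4 : 0 ≤ μ * X ^ 2 * B := by positivity
      linarith
    calc |2 * y * deriv f y + (μ * lam ^ 2 - χ + 4 * π ^ 2 * y ^ 4 - μ * y ^ 2) * f y|
        ≤ 2 * X * B + (δ * lam ^ 2 + 4 * π ^ 2 * X ^ 4 + μ * X ^ 2) * B :=
          (abs_add_le _ _).trans (by linarith)
      _ ≤ εr * (3 / 4 * lam ^ 2) := hsum
      _ ≤ εr * (lam ^ 2 - y ^ 2) := mul_le_mul_of_nonneg_left hden hεr0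
  -- the comparison system
  have hhc : Continuous h := continuous_iff_continuousAt.2 fun y ↦ (hh y).continuousAt
  have hh'c : Continuous h' := continuous_iff_continuousAt.2 fun y ↦ (hh' y).continuousAt
  set V : ℝ → ℝ × ℝ := fun y ↦ (f y - c * h y, deriv f y - c * h' y) with hV
  have hcont : ContinuousOn V (Icc 0 X) :=
    (((hf.contDiffOn.continuousOn.mono (Icc_subset_Icc (by linarith) (by linarith))).sub
      ((continuous_const.mul hhc).continuousOn)).prodMk
      ((hf.continuousOn_deriv.mono hsub).sub ((continuous_const.mul hh'c).continuousOn)))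
  have hder : ∀ y ∈ Ico 0 X, HasDerivWithinAt V
      (deriv f y - c * h' y,
        (2 * y * deriv f y + ((2 * π * lam * y) ^ 2 - χ) * f y) / (lam ^ 2 - y ^ 2)
          - c * ((4 * π ^ 2 * y ^ 2 - μ) * h y)) (Ici y) y := by
    intro y hy
    have hy' : y ∈ Ioo (-lam) lam := hsub ⟨hy.1, hy.2.le⟩
    exact (((hf.differentiableAt hy').hasDerivAt.sub ((hh y).const_mul c)).prodMk
      ((hf.hasDerivAt_deriv hχ hy').sub ((hh' y).const_mul c))).hasDerivWithinAt
  have h0 : ‖V 0‖ ≤ 0 := by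
    have e1 : f 0 - c * h 0 = 0 := by rw [hc]; field_simp; ring
    have e2 : deriv f 0 - c * h' 0 = 0 := by rw [hf.deriv_zero, hh'0]; ring
    simp only [hV, e1, e2, Prod.norm_mk, Real.norm_eq_abs, abs_zero, max_self, le_refl]
  have hbound : ∀ y ∈ Ico 0 X,
      ‖(deriv f y - c * h' y,
        (2 * y * deriv f y + ((2 * π * lam * y) ^ 2 - χ) * f y) / (lam ^ 2 - y ^ 2)
          - c * ((4 * π ^ 2 * y ^ 2 - μ) * h y))‖ ≤ K * ‖V y‖ + εr := by
    intro y hy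
    rw [Prod.norm_mk, Real.norm_eq_abs, Real.norm_eq_abs]
    have hm1 : |f y - c * h y| ≤ ‖V y‖ := by
      rw [hV, Prod.norm_mk, Real.norm_eq_abs, Real.norm_eq_abs]; exact le_max_left _ _
    have hm2 : |deriv f y - c * h' y| ≤ ‖V y‖ := by
      rw [hV, Prod.norm_mk, Real.norm_eq_abs, Real.norm_eq_abs]; exact le_max_right _ _
    have hm0 : 0 ≤ ‖V y‖ := norm_nonneg _
    have hKV : ‖V y‖ ≤ K * ‖V y‖ := by
      have := mul_le_mul_of_nonneg_right hK1 hm0; linarith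
    refine max_le (by linarith) ?_
    have hq : |4 * π ^ 2 * y ^ 2 - μ| ≤ K := by
      rw [hK]
      have hy2 : y ^ 2 ≤ X ^ 2 := pow_le_pow_left₀ hy.1 hy.2.le 2
      have a1 : 0 ≤ π ^ 2 * y ^ 2 := by positivity
      have a2 : π ^ 2 * y ^ 2 ≤ π ^ 2 * X ^ 2 := mul_le_mul_of_nonneg_left hy2 (by positivity)
      exact abs_le.2 ⟨by linarith, by linarith⟩
    have e : (2 * y * deriv f y + ((2 * π * lam * y) ^ 2 - χ) * f y) / (lam ^ 2 - y ^ 2)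
          - c * ((4 * π ^ 2 * y ^ 2 - μ) * h y)
        = (4 * π ^ 2 * y ^ 2 - μ) * (f y - c * h y)
          + ((2 * y * deriv f y + ((2 * π * lam * y) ^ 2 - χ) * f y) / (lam ^ 2 - y ^ 2)
            - (4 * π ^ 2 * y ^ 2 - μ) * f y) := by ring
    rw [e]
    have hr := hdef y hy
    calc |(4 * π ^ 2 * y ^ 2 - μ) * (f y - c * h y)
          + ((2 * y * deriv f y + ((2 * π * lam * y) ^ 2 - χ) * f y) / (lam ^ 2 - y ^ 2)
            - (4 * π ^ 2 * y ^ 2 - μ) * f y)|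
        ≤ |(4 * π ^ 2 * y ^ 2 - μ)| * |f y - c * h y| + εr := by
          refine (abs_add_le _ _).trans ?_
          rw [abs_mul]; linarith
      _ ≤ K * ‖V y‖ + εr := by
          have := mul_le_mul hq hm1 (abs_nonneg _) hKpos.le
          linarith
  have hG := norm_le_gronwallBound_of_norm_deriv_right_le hcont hder h0 hbound x hx
  rw [gronwallBound_of_K_ne_0 hKpos.ne', sub_zero] at hG
  simp only [zero_mul, zero_add] at hG
  -- `εr/K · (e^{Kx} − 1) ≤ εr · e^{KX}`
  have hexp1 : Real.exp (K * x) - 1 ≤ Real.exp (K * X) := by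
    have := Real.exp_le_exp.2 (show K * x ≤ K * X by nlinarith [hx.2]); linarith
  have hfinal : εr / K * (Real.exp (K * x) - 1) ≤ εr * Real.exp (K * X) := by
    have h1 : εr / K ≤ εr := div_le_self hεr0 hK1
    have h2 : 0 ≤ Real.exp (K * x) - 1 := by
      have := Real.one_le_exp (show 0 ≤ K * x by nlinarith [hx.1]); linarith
    calc εr / K * (Real.exp (K * x) - 1) ≤ εr * (Real.exp (K * x) - 1) :=
          mul_le_mul_of_nonneg_right h1 h2
      _ ≤ εr * Real.exp (K * X) := mul_le_mul_of_nonneg_left hexp1 hεr0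
  have hη : εr * Real.exp (K * X)
      = f 0 * (2 * Real.exp (8 * (4 * π ^ 2 * X ^ 2 + μ + 2) * X) * (δ + Cx / lam ^ 2)) := by
    rw [hεr, hB]
    have e2 : Real.exp (8 * (4 * π ^ 2 * X ^ 2 + μ + 2) * X)
        = Real.exp (K * X) * Real.exp (K * X) := by
      rw [← Real.exp_add]; congr 1; rw [hK]; ring
    rw [e2]; ring
  have hVx : ‖V x‖ ≤ f 0 * (2 * Real.exp (8 * (4 * π ^ 2 * X ^ 2 + μ + 2) * X)
      * (δ + Cx / lam ^ 2)) := hG.trans (hfinal.trans hη.le)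
  rw [hV, Prod.norm_mk, Real.norm_eq_abs, Real.norm_eq_abs] at hVx
  exact ⟨(le_max_left _ _).trans hVx, (le_max_right _ _).trans hVx⟩

/-- **Tail bounds past the window** (turning-point estimates): if `|χ − μλ²| ≤ δλ²` and
`D = 4π²X² − μ − δ > 0`, `0 ≤ X`, `X + 1 ≤ λ`, then `λ|f(λ)| ≤ 2|f′(X)|/D`, `∫_X^λ |f| ≤ |f′(X)|/D`,
`∫_X^λ f² ≤ |f(X)|·|f′(X)|/D` and `∫_X^λ |f′|(1+t) ≤ (1+X)|f(X)| + 5|f′(X)|/D`.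
[cite: SlepianPollak1961, §III; folklore] -/
theorem tail_bounds (hf : IsProlateFunction lam n f) {χ : ℝ}
    (hχ : ∀ x ∈ Ioo (-lam) lam,
      -(deriv (fun y ↦ (lam ^ 2 - y ^ 2) * deriv f y) x) + (2 * π * lam * x) ^ 2 * f x = χ * f x)
    {X μ δ : ℝ} (hX : 0 ≤ X) (hXl : X + 1 ≤ lam) (hχδ : |χ - μ * lam ^ 2| ≤ δ * lam ^ 2)
    (hD : 0 < 4 * π ^ 2 * X ^ 2 - μ - δ) :
    lam * |f lam| ≤ 2 * |deriv f X| / (4 * π ^ 2 * X ^ 2 - μ - δ) ∧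
    (∫ t in X..lam, |f t|) ≤ |deriv f X| / (4 * π ^ 2 * X ^ 2 - μ - δ) ∧
    (∫ t in X..lam, f t ^ 2) ≤ |f X| * |deriv f X| / (4 * π ^ 2 * X ^ 2 - μ - δ) ∧
    (∫ t in X..lam, |deriv f t| * (1 + t))
      ≤ (1 + X) * |f X| + 5 * |deriv f X| / (4 * π ^ 2 * X ^ 2 - μ - δ) := by
  have hlam := hf.lam_pos
  have hl2 : 0 < lam ^ 2 := by positivity
  set D : ℝ := 4 * π ^ 2 * X ^ 2 - μ - δ with hDdef
  have hXlam : X < lam := by linarith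
  have hcoefD : D * lam ^ 2 ≤ (2 * π * lam * X) ^ 2 - χ := by
    have := (abs_le.1 hχδ).2
    have e : (2 * π * lam * X) ^ 2 = 4 * π ^ 2 * X ^ 2 * lam ^ 2 := by ring
    rw [e, hDdef]; nlinarith
  have hDl2 : 0 < D * lam ^ 2 := mul_pos hD hl2
  have hcoef : χ < (2 * π * lam * X) ^ 2 := by linarith
  have hχ₀ : χ ≤ (2 * π * lam * X) ^ 2 := hcoef.le
  have hXI : X ∈ Ico X lam := ⟨le_rfl, hXlam⟩
  -- (a)
  have ha : lam * |f lam| ≤ 2 * |deriv f X| / D := by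
    have h1 := hf.abs_apply_lam_le_deriv_of_turning hχ hX hχ₀ hXI hcoef
    have h2 : (lam + X) * |deriv f X| ≤ 2 * lam * |deriv f X| :=
      mul_le_mul_of_nonneg_right (by linarith) (abs_nonneg _)
    have h3 : D * lam ^ 2 * |f lam| ≤ ((2 * π * lam * X) ^ 2 - χ) * |f lam| :=
      mul_le_mul_of_nonneg_right hcoefD (abs_nonneg _)
    rw [le_div_iff₀ hD]
    refine le_of_mul_le_mul_right ?_ hlam
    nlinarith
  -- (b)
  have hI0 : 0 ≤ ∫ t in X..lam, |f t| :=
    intervalIntegral.integral_nonneg hXlam.le fun t _ ↦ abs_nonneg _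
  have hb : (∫ t in X..lam, |f t|) ≤ |deriv f X| / D := by
    have h1 := hf.integral_abs_le_of_turning hχ hX hχ₀ hXI hcoef
    have h2 : (lam ^ 2 - X ^ 2) * |deriv f X| ≤ lam ^ 2 * |deriv f X| :=
      mul_le_mul_of_nonneg_right (by nlinarith) (abs_nonneg _)
    have h3 : D * lam ^ 2 * (∫ t in X..lam, |f t|)
        ≤ ((2 * π * lam * X) ^ 2 - χ) * ∫ t in X..lam, |f t| :=
      mul_le_mul_of_nonneg_right hcoefD hI0
    rw [le_div_iff₀ hD]
    refine le_of_mul_le_mul_right ?_ hl2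
    nlinarith
  -- (c)
  have hcontI : ContinuousOn f (Icc X lam) :=
    hf.contDiffOn.continuousOn.mono (Icc_subset_Icc (by linarith) le_rfl)
  have hc : (∫ t in X..lam, f t ^ 2) ≤ |f X| * |deriv f X| / D := by
    have hmono : (∫ t in X..lam, f t ^ 2) ≤ ∫ t in X..lam, |f X| * |f t| := by
      refine intervalIntegral.integral_mono_on hXlam.le
        ((hcontI.pow 2).intervalIntegrable_of_Icc hXlam.le)
        ((continuousOn_const.mul hcontI.abs).intervalIntegrable_of_Icc hXlam.le) ?_
      intro t ht
      have hft : |f t| ≤ |f X| := by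
        rcases eq_or_lt_of_le ht.2 with h | h
        · rw [h]; exact hf.abs_apply_lam_le_of_turning hχ hX hχ₀ hXI
        · exact hf.abs_antitoneOn_of_turning hχ hX hχ₀ hXI ⟨ht.1, h⟩ ht.1
      calc f t ^ 2 = |f t| * |f t| := by rw [← sq, sq_abs]
        _ ≤ |f X| * |f t| := mul_le_mul_of_nonneg_right hft (abs_nonneg _)
    rw [intervalIntegral.integral_const_mul] at hmono
    calc (∫ t in X..lam, f t ^ 2) ≤ |f X| * ∫ t in X..lam, |f t| := hmono
      _ ≤ |f X| * (|deriv f X| / D) := mul_le_mul_of_nonneg_left hb (abs_nonneg _)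
      _ = |f X| * |deriv f X| / D := by ring
  -- (d)
  have hd : (∫ t in X..lam, |deriv f t| * (1 + t)) ≤ (1 + X) * |f X| + 5 * |deriv f X| / D := by
    have h1 := hf.integral_abs_deriv_mul_le_of_turning hχ hX hχ₀ hXI
    have h2 : (1 + lam) * |f lam| ≤ 2 * (lam * |f lam|) := by
      nlinarith [abs_nonneg (f lam)]
    have h3 : (1 + lam) * |f lam| ≤ 4 * |deriv f X| / D := by
      calc (1 + lam) * |f lam| ≤ 2 * (lam * |f lam|) := h2
        _ ≤ 2 * (2 * |deriv f X| / D) := by linarith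
        _ = 4 * |deriv f X| / D := by ring
    have e : 5 * |deriv f X| / D = |deriv f X| / D + 4 * |deriv f X| / D := by ring
    linarith
  exact ⟨ha, hb, hc, hd⟩

/-- `∫_0^λ f² = 1/2` for a prolate function (evenness and `norm_one`). [folklore] -/
theorem integral_sq_half (hf : IsProlateFunction lam n f) :
    ∫ x in (0 : ℝ)..lam, f x ^ 2 = 1 / 2 := by
  have hlam := hf.lam_pos
  have hfi : IntervalIntegrable (fun x ↦ f x ^ 2) volume (-lam) lam :=
    (hf.contDiffOn.continuousOn.pow 2).intervalIntegrable_of_Icc (by linarith)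
  have h := integral_neg_self_eq_two_mul_of_even hlam.le (f := fun x ↦ f x ^ 2)
    (fun x ↦ by simp only [hf.even x]) hfi
  have h1 := hf.norm_one
  linarith

/-- Window bounds in the scale `c = f(0)/h(0)`: `|f − ch|, |f′ − ch′| ≤ c·t` on `[0, X]` once
`h(0)·η ≤ t`. [folklore] -/
theorem window_ct (hf : IsProlateFunction lam n f) {χ : ℝ}
    (hχ : ∀ x ∈ Ioo (-lam) lam,
      -(deriv (fun y ↦ (lam ^ 2 - y ^ 2) * deriv f y) x) + (2 * π * lam * x) ^ 2 * f x = χ * f x)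
    {X μ δ : ℝ} (hX : 0 ≤ X) (hμ : 0 ≤ μ) (hδ0 : 0 ≤ δ) (hδ1 : δ ≤ 1) (hl : 2 * X + 2 ≤ lam)
    (hχ0 : 0 ≤ χ) (hχδ : |χ - μ * lam ^ 2| ≤ δ * lam ^ 2)
    {h h' : ℝ → ℝ} (hh : ∀ x, HasDerivAt h (h' x) x)
    (hh' : ∀ x, HasDerivAt h' ((4 * π ^ 2 * x ^ 2 - μ) * h x) x)
    (hh0 : 0 < h 0) (hh'0 : h' 0 = 0) {t : ℝ}
    (hwin : h 0 * (2 * Real.exp (8 * (4 * π ^ 2 * X ^ 2 + μ + 2) * X) *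
        (δ + (2 * X + 4 * π ^ 2 * X ^ 4 + μ * X ^ 2) / lam ^ 2)) ≤ t)
    {x : ℝ} (hx : x ∈ Icc 0 X) :
    |f x - f 0 / h 0 * h x| ≤ f 0 / h 0 * t ∧
      |deriv f x - f 0 / h 0 * h' x| ≤ f 0 / h 0 * t := by
  obtain ⟨h1, h2⟩ := hf.window_compare hχ hX hμ hδ0 hδ1 hl hχ0 hχδ hh hh' hh0 hh'0 hx
  have hc : 0 < f 0 / h 0 := div_pos hf.pos_zero hh0
  have e : f 0 * (2 * Real.exp (8 * (4 * π ^ 2 * X ^ 2 + μ + 2) * X) *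
        (δ + (2 * X + 4 * π ^ 2 * X ^ 4 + μ * X ^ 2) / lam ^ 2))
      = f 0 / h 0 * (h 0 * (2 * Real.exp (8 * (4 * π ^ 2 * X ^ 2 + μ + 2) * X) *
        (δ + (2 * X + 4 * π ^ 2 * X ^ 4 + μ * X ^ 2) / lam ^ 2))) := by
    field_simp
  have hb := mul_le_mul_of_nonneg_left hwin hc.le
  rw [← e] at hb
  exact ⟨h1.trans hb, h2.trans hb⟩

set_option maxHeartbeats 800000 in
/-- **Scale pinning.** Under the window/tail hypotheses with smallness parameters `t ≤ ω`,
`X(1+X)t ≤ ω`, `8(2H+3)ω ≤ 1` (`|h| ≤ H`), `(1+X)|h(X)|, |h′(X)|, |∫_0^X h² − 1/2| ≤ ω`, the scale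
`c = f(0)/h(0)` satisfies `c ≤ 3/2` and `|c − 1| ≤ 4(2H+3)ω` (from `∫_{−λ}^{λ} f² = 1`). [folklore] -/
theorem core_scale (hf : IsProlateFunction lam n f) {χ : ℝ}
    (hχ : ∀ x ∈ Ioo (-lam) lam,
      -(deriv (fun y ↦ (lam ^ 2 - y ^ 2) * deriv f y) x) + (2 * π * lam * x) ^ 2 * f x = χ * f x)
    {X μ δ : ℝ} (hX2 : 2 ≤ X) (hμ : 1 ≤ μ) (hδ0 : 0 ≤ δ) (hδ1 : δ ≤ 1) (hl : 2 * X + 2 ≤ lam)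
    (hχ0 : 0 ≤ χ) (hχδ : |χ - μ * lam ^ 2| ≤ δ * lam ^ 2) (hD : 1 ≤ 4 * π ^ 2 * X ^ 2 - μ - δ)
    {h h' : ℝ → ℝ} (hh : ∀ x, HasDerivAt h (h' x) x)
    (hh' : ∀ x, HasDerivAt h' ((4 * π ^ 2 * x ^ 2 - μ) * h x) x)
    (hh0 : 0 < h 0) (hh'0 : h' 0 = 0) {H : ℝ} (hH : ∀ x, |h x| ≤ H) {ω t : ℝ}
    (ht0 : 0 ≤ t) (htω : t ≤ ω) (hXt : X * (1 + X) * t ≤ ω) (hωs : 8 * (2 * H + 3) * ω ≤ 1)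
    (hwin : h 0 * (2 * Real.exp (8 * (4 * π ^ 2 * X ^ 2 + μ + 2) * X) *
        (δ + (2 * X + 4 * π ^ 2 * X ^ 4 + μ * X ^ 2) / lam ^ 2)) ≤ t)
    (hω1 : (1 + X) * |h X| ≤ ω) (hω2 : |h' X| ≤ ω)
    (hω3 : |(∫ x in (0 : ℝ)..X, h x ^ 2) - 1 / 2| ≤ ω) :
    f 0 / h 0 ≤ 3 / 2 ∧ |f 0 / h 0 - 1| ≤ 4 * (2 * H + 3) * ω := by
  have hlam := hf.lam_pos
  have hX : 0 ≤ X := by linarith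
  have hH0 : 0 ≤ H := (abs_nonneg _).trans (hH 0)
  have hω0 : 0 ≤ ω := ht0.trans htω
  have hω4 : ω ≤ 1 / 24 := by nlinarith
  set c : ℝ := f 0 / h 0 with hc
  have hc0 : 0 < c := div_pos hf.pos_zero hh0
  have hct : ∀ x ∈ Icc 0 X, |f x - c * h x| ≤ c * t ∧ |deriv f x - c * h' x| ≤ c * t :=
    fun x hx ↦ hf.window_ct hχ hX (by linarith) hδ0 hδ1 hl hχ0 hχδ hh hh' hh0 hh'0 hwin hx
  have hXt' : X * t ≤ ω := by nlinarith
  -- values at `X`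
  have hXI : X ∈ Icc 0 X := ⟨hX, le_rfl⟩
  have hhX : |h X| ≤ ω := by nlinarith [abs_nonneg (h X)]
  have hfX : |f X| ≤ 2 * c * ω := by
    have h1 := (hct X hXI).1
    have : |f X| ≤ |f X - c * h X| + |c * h X| := by
      calc |f X| = |(f X - c * h X) + c * h X| := by ring_nf
        _ ≤ _ := abs_add_le _ _
    rw [abs_mul, abs_of_pos hc0] at this
    nlinarith [mul_le_mul_of_nonneg_left hhX hc0.le, mul_le_mul_of_nonneg_left htω hc0.le]
  have hf'X : |deriv f X| ≤ 2 * c * ω := by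
    have h1 := (hct X hXI).2
    have : |deriv f X| ≤ |deriv f X - c * h' X| + |c * h' X| := by
      calc |deriv f X| = |(deriv f X - c * h' X) + c * h' X| := by ring_nf
        _ ≤ _ := abs_add_le _ _
    rw [abs_mul, abs_of_pos hc0] at this
    nlinarith [mul_le_mul_of_nonneg_left hω2 hc0.le, mul_le_mul_of_nonneg_left htω hc0.le]
  -- tail of `f²`
  obtain ⟨-, -, hT, -⟩ := hf.tail_bounds hχ hX (by linarith) hχδ (by linarith)
  have hT' : (∫ x in X..lam, f x ^ 2) ≤ 4 * c ^ 2 * ω ^ 2 := by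
    have h1 : |f X| * |deriv f X| / (4 * π ^ 2 * X ^ 2 - μ - δ) ≤ |f X| * |deriv f X| :=
      div_le_self (by positivity) hD
    have h2 : |f X| * |deriv f X| ≤ (2 * c * ω) * (2 * c * ω) :=
      mul_le_mul hfX hf'X (abs_nonneg _) (by positivity)
    nlinarith
  have hT0 : 0 ≤ ∫ x in X..lam, f x ^ 2 :=
    intervalIntegral.integral_nonneg (by linarith) fun x _ ↦ sq_nonneg _
  -- window part of `f²`
  have hfc : ContinuousOn f (Icc (-lam) lam) := hf.contDiffOn.continuousOn
  have hhc : Continuous h := continuous_iff_continuousAt.2 fun y ↦ (hh y).continuousAt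
  have if0X : IntervalIntegrable (fun x ↦ f x ^ 2) volume 0 X :=
    ((hfc.mono (Icc_subset_Icc (by linarith) (by linarith))).pow 2).intervalIntegrable_of_Icc hX
  have ifXl : IntervalIntegrable (fun x ↦ f x ^ 2) volume X lam :=
    ((hfc.mono (Icc_subset_Icc (by linarith) le_rfl)).pow 2).intervalIntegrable_of_Icc (by linarith)
  have ih : IntervalIntegrable (fun x ↦ c ^ 2 * h x ^ 2) volume 0 X :=
    ((continuous_const.mul (hhc.pow 2)).intervalIntegrable _ _)
  have hsplit : (∫ x in (0 : ℝ)..X, f x ^ 2) + (∫ x in X..lam, f x ^ 2) = 1 / 2 := by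
    rw [intervalIntegral.integral_add_adjacent_intervals if0X ifXl, hf.integral_sq_half]
  have hW : |(∫ x in (0 : ℝ)..X, f x ^ 2) - c ^ 2 * ∫ x in (0 : ℝ)..X, h x ^ 2|
      ≤ c ^ 2 * (2 * H + 1) * ω := by
    rw [← intervalIntegral.integral_const_mul, ← intervalIntegral.integral_sub if0X ih]
    have hb := intervalIntegral.norm_integral_le_of_norm_le_const (a := 0) (b := X)
      (C := c ^ 2 * t * (t + 2 * H)) (f := fun x ↦ f x ^ 2 - c ^ 2 * h x ^ 2) (fun x hx ↦ by
        rw [uIoc_of_le hX] at hx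
        obtain ⟨h1, -⟩ := hct x ⟨hx.1.le, hx.2⟩
        rw [Real.norm_eq_abs]
        have e : f x ^ 2 - c ^ 2 * h x ^ 2 = (f x - c * h x) * ((f x - c * h x) + 2 * (c * h x)) := by
          ring
        rw [e, abs_mul]
        have h2 : |(f x - c * h x) + 2 * (c * h x)| ≤ c * t + 2 * (c * H) := by
          calc _ ≤ |f x - c * h x| + |2 * (c * h x)| := abs_add_le _ _
            _ ≤ c * t + 2 * (c * H) := by
                rw [abs_mul, abs_mul, abs_two, abs_of_pos hc0]
                nlinarith [mul_le_mul_of_nonneg_left (hH x) hc0.le]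
        calc |f x - c * h x| * |(f x - c * h x) + 2 * (c * h x)|
            ≤ (c * t) * (c * t + 2 * (c * H)) := mul_le_mul h1 h2 (abs_nonneg _) (by positivity)
          _ = c ^ 2 * t * (t + 2 * H) := by ring)
    rw [Real.norm_eq_abs, sub_zero, abs_of_nonneg hX] at hb
    have h3 : c ^ 2 * t * (t + 2 * H) * X ≤ c ^ 2 * (2 * H + 1) * ω := by
      have h4 : t * (t + 2 * H) * X ≤ (2 * H + 1) * ω := by
        have : t ≤ 1 := htω.trans (by linarith)
        nlinarith [mul_nonneg (mul_nonneg ht0 hX) hH0, mul_nonneg ht0 hX]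
      nlinarith [mul_le_mul_of_nonneg_left h4 (sq_nonneg c)]
    exact hb.trans h3
  -- consequences
  set I : ℝ := ∫ x in (0 : ℝ)..X, h x ^ 2 with hI
  set F : ℝ := ∫ x in (0 : ℝ)..X, f x ^ 2 with hF
  have hI1 : 1 / 2 - ω ≤ I := by have := (abs_le.1 hω3).1; linarith
  have hI2 : I ≤ 1 / 2 + ω := by have := (abs_le.1 hω3).2; linarith
  have hW1 := (abs_le.1 hW).1
  have hW2 := (abs_le.1 hW).2
  have hc2 : 0 ≤ c ^ 2 := sq_nonneg c
  -- upper bound on `c²`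
  have hHω : 0 ≤ (2 * H + 3) * ω := by positivity
  have hup : c ^ 2 * (1 / 2 - (2 * H + 2) * ω) ≤ 1 / 2 := by
    have := mul_le_mul_of_nonneg_left hI1 hc2
    linarith
  have hc43 : c ^ 2 ≤ 4 / 3 := by
    have h38 : 3 / 8 ≤ 1 / 2 - (2 * H + 2) * ω := by nlinarith
    have := mul_le_mul_of_nonneg_left h38 hc2
    linarith
  have hc32 : c ≤ 3 / 2 := by nlinarith [hc0, hc43]
  have hupper : c ^ 2 - 1 ≤ 4 * (2 * H + 3) * ω := by
    have h1 : c ^ 2 * ((2 * H + 2) * ω) ≤ 4 / 3 * ((2 * H + 2) * ω) :=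
      mul_le_mul_of_nonneg_right hc43 (by positivity)
    linarith
  -- lower bound on `c²`
  have hlow : 1 / 2 ≤ c ^ 2 * (1 / 2 + (2 * H + 3) * ω) := by
    have h1 := mul_le_mul_of_nonneg_left hI2 hc2
    have hω2' : 4 * ω ^ 2 ≤ ω := by nlinarith
    have h2 := mul_le_mul_of_nonneg_left hω2' hc2
    linarith
  have hlower : 1 - c ^ 2 ≤ 4 * (2 * H + 3) * ω := by
    have h1 : c ^ 2 * ((2 * H + 3) * ω) ≤ 4 / 3 * ((2 * H + 3) * ω) :=
      mul_le_mul_of_nonneg_right hc43 hHω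
    linarith
  refine ⟨hc32, ?_⟩
  have key : |c - 1| ≤ |c ^ 2 - 1| := by
    have e : c ^ 2 - 1 = (c - 1) * (c + 1) := by ring
    rw [e, abs_mul]
    have h1 : 1 ≤ |c + 1| := by rw [abs_of_pos (by linarith)]; linarith
    have h2 := mul_le_mul_of_nonneg_left h1 (abs_nonneg (c - 1))
    linarith
  exact key.trans (abs_le.2 ⟨by linarith, by linarith⟩)

set_option maxHeartbeats 800000 in
/-- **Core estimates.** Under the hypotheses of `core_scale` and the tail/size data of `h`
(`∫_X^λ |h|, ∫_X^λ |h′|(1+x) ≤ ω`, `∫_0^X |h| ≤ L`, `∫_0^X |h′|(1+x) ≤ L′`):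
`λ|f(λ)| ≤ 6ω`, `∫_0^λ |f − h| ≤ (6 + 4(2H+3)L)ω`, `∫_0^λ |f′ − h′|(1+x) ≤ (21 + 4(2H+3)L′)ω`.
[cite: SlepianPollak1961, §III; folklore] -/
theorem core_outputs (hf : IsProlateFunction lam n f) {χ : ℝ}
    (hχ : ∀ x ∈ Ioo (-lam) lam,
      -(deriv (fun y ↦ (lam ^ 2 - y ^ 2) * deriv f y) x) + (2 * π * lam * x) ^ 2 * f x = χ * f x)
    {X μ δ : ℝ} (hX2 : 2 ≤ X) (hμ : 1 ≤ μ) (hδ0 : 0 ≤ δ) (hδ1 : δ ≤ 1) (hl : 2 * X + 2 ≤ lam)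
    (hχ0 : 0 ≤ χ) (hχδ : |χ - μ * lam ^ 2| ≤ δ * lam ^ 2) (hD : 1 ≤ 4 * π ^ 2 * X ^ 2 - μ - δ)
    {h h' : ℝ → ℝ} (hh : ∀ x, HasDerivAt h (h' x) x)
    (hh' : ∀ x, HasDerivAt h' ((4 * π ^ 2 * x ^ 2 - μ) * h x) x)
    (hh0 : 0 < h 0) (hh'0 : h' 0 = 0) {H : ℝ} (hH : ∀ x, |h x| ≤ H) {ω t : ℝ}
    (ht0 : 0 ≤ t) (htω : t ≤ ω) (hXt : X * (1 + X) * t ≤ ω) (hωs : 8 * (2 * H + 3) * ω ≤ 1)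
    (hwin : h 0 * (2 * Real.exp (8 * (4 * π ^ 2 * X ^ 2 + μ + 2) * X) *
        (δ + (2 * X + 4 * π ^ 2 * X ^ 4 + μ * X ^ 2) / lam ^ 2)) ≤ t)
    (hω1 : (1 + X) * |h X| ≤ ω) (hω2 : |h' X| ≤ ω)
    (hω3 : |(∫ x in (0 : ℝ)..X, h x ^ 2) - 1 / 2| ≤ ω)
    (hω4 : (∫ x in X..lam, |h x|) ≤ ω) (hω5 : (∫ x in X..lam, |h' x| * (1 + x)) ≤ ω)
    {L L' : ℝ} (hLX : (∫ x in (0 : ℝ)..X, |h x|) ≤ L)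
    (hL'X : (∫ x in (0 : ℝ)..X, |h' x| * (1 + x)) ≤ L') :
    lam * |f lam| ≤ 6 * ω ∧
    (∫ x in (0 : ℝ)..lam, |f x - h x|) ≤ (6 + 4 * (2 * H + 3) * L) * ω ∧
    (∫ x in (0 : ℝ)..lam, |deriv f x - h' x| * (1 + x)) ≤ (21 + 4 * (2 * H + 3) * L') * ω := by
  have hlam := hf.lam_pos
  have hX : 0 ≤ X := by linarith
  have hXl : X ≤ lam := by linarith
  have hH0 : 0 ≤ H := (abs_nonneg _).trans (hH 0)
  have hω0 : 0 ≤ ω := ht0.trans htω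
  set c : ℝ := f 0 / h 0 with hc
  have hc0 : 0 < c := div_pos hf.pos_zero hh0
  obtain ⟨hc32, hγ⟩ := hf.core_scale hχ hX2 hμ hδ0 hδ1 hl hχ0 hχδ hD hh hh' hh0 hh'0 hH ht0 htω
    hXt hωs hwin hω1 hω2 hω3
  set γ : ℝ := 4 * (2 * H + 3) * ω with hγdef
  have hγ0 : 0 ≤ γ := by positivity
  have hc32' : c ≤ 3 / 2 := by rw [hc]; exact hc32
  have hγ' : |c - 1| ≤ γ := by rw [hc]; exact hγ
  have hct : ∀ x ∈ Icc 0 X, |f x - c * h x| ≤ c * t ∧ |deriv f x - c * h' x| ≤ c * t :=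
    fun x hx ↦ hf.window_ct hχ hX (by linarith) hδ0 hδ1 hl hχ0 hχδ hh hh' hh0 hh'0 hwin hx
  have hcω' : c * ω ≤ 3 / 2 * ω := mul_le_mul_of_nonneg_right hc32' hω0
  have hcω : c * t ≤ 3 / 2 * ω := by
    have := mul_le_mul_of_nonneg_left htω hc0.le; linarith
  -- values at `X`
  have hXI : X ∈ Icc 0 X := ⟨hX, le_rfl⟩
  have h1XfX : (1 + X) * |f X| ≤ 2 * c * ω := by
    have h1 := (hct X hXI).1
    have h2 : |f X| ≤ c * t + c * |h X| := by
      calc |f X| = |(f X - c * h X) + c * h X| := by ring_nf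
        _ ≤ |f X - c * h X| + |c * h X| := abs_add_le _ _
        _ ≤ c * t + c * |h X| := by rw [abs_mul, abs_of_pos hc0]; linarith
    have h3 : (1 + X) * t ≤ ω := by nlinarith
    have h4 := mul_le_mul_of_nonneg_left h2 (by linarith : (0:ℝ) ≤ 1 + X)
    have h5 := mul_le_mul_of_nonneg_left hω1 hc0.le
    have h6 := mul_le_mul_of_nonneg_left h3 hc0.le
    linarith only [h1, h4, h5, h6]
  have hfX : |f X| ≤ 2 * c * ω := by
    have := mul_nonneg hX (abs_nonneg (f X))
    linarith
  have hf'X : |deriv f X| ≤ 2 * c * ω := by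
    have h1 := (hct X hXI).2
    have h2 : |deriv f X| ≤ |deriv f X - c * h' X| + |c * h' X| := by
      calc |deriv f X| = |(deriv f X - c * h' X) + c * h' X| := by ring_nf
        _ ≤ _ := abs_add_le _ _
    rw [abs_mul, abs_of_pos hc0] at h2
    have m1 := mul_le_mul_of_nonneg_left hω2 hc0.le
    have m2 := mul_le_mul_of_nonneg_left htω hc0.le
    linarith only [h1, h2, m1, m2]
  -- tails of `f`
  obtain ⟨ha, hb, -, hd⟩ := hf.tail_bounds hχ hX (by linarith) hχδ (by linarith)
  have hDpos : 0 < 4 * π ^ 2 * X ^ 2 - μ - δ := by linarith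
  have hdiv : ∀ a : ℝ, 0 ≤ a → a / (4 * π ^ 2 * X ^ 2 - μ - δ) ≤ a := fun a ha ↦ div_le_self ha hD
  have hq := hdiv (|deriv f X|) (abs_nonneg _)
  have hE : lam * |f lam| ≤ 6 * ω := by
    have e : 2 * |deriv f X| / (4 * π ^ 2 * X ^ 2 - μ - δ)
        = 2 * (|deriv f X| / (4 * π ^ 2 * X ^ 2 - μ - δ)) := by ring
    linarith only [ha, e, hq, hf'X, hcω']
  have hTf : (∫ x in X..lam, |f x|) ≤ 3 * ω := by
    linarith only [hb, hq, hf'X, hcω']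
  have hTf' : (∫ x in X..lam, |deriv f x| * (1 + x)) ≤ 18 * ω := by
    have e : 5 * |deriv f X| / (4 * π ^ 2 * X ^ 2 - μ - δ)
        = 5 * (|deriv f X| / (4 * π ^ 2 * X ^ 2 - μ - δ)) := by ring
    linarith only [hd, e, hq, hf'X, h1XfX, hcω']
  -- integrability
  have hfc : ContinuousOn f (Icc (-lam) lam) := hf.contDiffOn.continuousOn
  have hhc : Continuous h := continuous_iff_continuousAt.2 fun y ↦ (hh y).continuousAt
  have hh'c : Continuous h' := continuous_iff_continuousAt.2 fun y ↦ (hh' y).continuousAt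
  have hf0X : ContinuousOn f (Icc 0 X) := hfc.mono (Icc_subset_Icc (by linarith) (by linarith))
  have hfXl : ContinuousOn f (Icc X lam) := hfc.mono (Icc_subset_Icc (by linarith) le_rfl)
  have hsub1 : uIcc 0 X ⊆ uIcc 0 lam := by
    rw [uIcc_of_le hX, uIcc_of_le hlam.le]; exact Icc_subset_Icc le_rfl hXl
  have hsub2 : uIcc X lam ⊆ uIcc 0 lam := by
    rw [uIcc_of_le hXl, uIcc_of_le hlam.le]; exact Icc_subset_Icc hX le_rfl
  have id0X : IntervalIntegrable (deriv f) volume 0 X := hf.intervalIntegrable_deriv.mono_set hsub1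
  have idXl : IntervalIntegrable (deriv f) volume X lam := hf.intervalIntegrable_deriv.mono_set hsub2
  -- (I1)
  have hI1 : (∫ x in (0 : ℝ)..lam, |f x - h x|) ≤ (6 + 4 * (2 * H + 3) * L) * ω := by
    have iW : IntervalIntegrable (fun x ↦ |f x - h x|) volume 0 X :=
      ((hf0X.sub hhc.continuousOn).abs).intervalIntegrable_of_Icc hX
    have iT : IntervalIntegrable (fun x ↦ |f x - h x|) volume X lam :=
      ((hfXl.sub hhc.continuousOn).abs).intervalIntegrable_of_Icc hXl
    rw [← intervalIntegral.integral_add_adjacent_intervals iW iT]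
    have hWb : (∫ x in (0 : ℝ)..X, |f x - h x|) ≤ ∫ x in (0 : ℝ)..X, (c * t + γ * |h x|) := by
      refine intervalIntegral.integral_mono_on hX iW
        ((continuous_const.add (continuous_const.mul hhc.abs)).intervalIntegrable _ _) ?_
      intro x hx
      have h1 := (hct x hx).1
      calc |f x - h x| = |(f x - c * h x) + (c - 1) * h x| := by ring_nf
        _ ≤ |f x - c * h x| + |(c - 1) * h x| := abs_add_le _ _
        _ ≤ c * t + γ * |h x| := by
            rw [abs_mul]
            exact add_le_add h1 (mul_le_mul_of_nonneg_right hγ' (abs_nonneg _))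
    have iγ : IntervalIntegrable (fun x ↦ γ * |h x|) volume 0 X :=
      (continuous_const.mul hhc.abs).intervalIntegrable _ _
    have ic : IntervalIntegrable (fun _ : ℝ ↦ c * t) volume 0 X := intervalIntegrable_const
    have hWe : (∫ x in (0 : ℝ)..X, (c * t + γ * |h x|))
        = c * t * X + γ * ∫ x in (0 : ℝ)..X, |h x| := by
      rw [intervalIntegral.integral_add ic iγ, intervalIntegral.integral_const,
        intervalIntegral.integral_const_mul]
      simp only [sub_zero, smul_eq_mul]
      ring
    have hTb : (∫ x in X..lam, |f x - h x|) ≤ ∫ x in X..lam, (|f x| + |h x|) :=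
      intervalIntegral.integral_mono_on hXl iT
        ((hfXl.abs.add hhc.continuousOn.abs).intervalIntegrable_of_Icc hXl)
        (fun x _ ↦ abs_sub _ _)
    have hTe : (∫ x in X..lam, (|f x| + |h x|))
        = (∫ x in X..lam, |f x|) + ∫ x in X..lam, |h x| :=
      intervalIntegral.integral_add (hfXl.abs.intervalIntegrable_of_Icc hXl)
        (hhc.abs.intervalIntegrable _ _)
    have hctX : c * t * X ≤ 3 / 2 * ω := by
      have e : c * t * X = c * (X * t) := by ring
      have hXt' : X * t ≤ ω := by nlinarith
      have m := mul_le_mul_of_nonneg_left hXt' hc0.le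
      linarith only [e, m, hcω']
    have hγL : γ * (∫ x in (0 : ℝ)..X, |h x|) ≤ γ * L := mul_le_mul_of_nonneg_left hLX hγ0
    have eγ : γ * L = 4 * (2 * H + 3) * L * ω := by rw [hγdef]; ring
    linarith only [hWb, hWe, hTb, hTe, hctX, hγL, eγ, hTf, hω4, hω0]
  -- (I3)
  have hI3 : (∫ x in (0 : ℝ)..lam, |deriv f x - h' x| * (1 + x))
      ≤ (21 + 4 * (2 * H + 3) * L') * ω := by
    have iW : IntervalIntegrable (fun x ↦ |deriv f x - h' x| * (1 + x)) volume 0 X :=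
      (id0X.sub (hh'c.intervalIntegrable _ _)).abs.mul_continuousOn (by fun_prop)
    have iT : IntervalIntegrable (fun x ↦ |deriv f x - h' x| * (1 + x)) volume X lam :=
      (idXl.sub (hh'c.intervalIntegrable _ _)).abs.mul_continuousOn (by fun_prop)
    rw [← intervalIntegral.integral_add_adjacent_intervals iW iT]
    have hk : Continuous fun x : ℝ ↦ |h' x| * (1 + x) := hh'c.abs.mul (by fun_prop)
    have hWb : (∫ x in (0 : ℝ)..X, |deriv f x - h' x| * (1 + x))
        ≤ ∫ x in (0 : ℝ)..X, (c * t * (1 + X) + γ * (|h' x| * (1 + x))) := by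
      refine intervalIntegral.integral_mono_on hX iW
        ((continuous_const.add (continuous_const.mul hk)).intervalIntegrable _ _) ?_
      intro x hx
      have h1 := (hct x hx).2
      have hx1 : 0 ≤ 1 + x := by linarith [hx.1]
      have h2 : |deriv f x - h' x| ≤ c * t + γ * |h' x| := by
        calc |deriv f x - h' x| = |(deriv f x - c * h' x) + (c - 1) * h' x| := by ring_nf
          _ ≤ |deriv f x - c * h' x| + |(c - 1) * h' x| := abs_add_le _ _
          _ ≤ c * t + γ * |h' x| := by
              rw [abs_mul]
              exact add_le_add h1 (mul_le_mul_of_nonneg_right hγ' (abs_nonneg _))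
      have h3 := mul_le_mul_of_nonneg_right h2 hx1
      have h4 : c * t * (1 + x) ≤ c * t * (1 + X) :=
        mul_le_mul_of_nonneg_left (by linarith [hx.2]) (by positivity)
      linarith only [h3, h4]
    have iγ : IntervalIntegrable (fun x ↦ γ * (|h' x| * (1 + x))) volume 0 X :=
      (continuous_const.mul hk).intervalIntegrable _ _
    have ic : IntervalIntegrable (fun _ : ℝ ↦ c * t * (1 + X)) volume 0 X := intervalIntegrable_const
    have hWe : (∫ x in (0 : ℝ)..X, (c * t * (1 + X) + γ * (|h' x| * (1 + x))))
        = c * t * (1 + X) * X + γ * ∫ x in (0 : ℝ)..X, |h' x| * (1 + x) := by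
      rw [intervalIntegral.integral_add ic iγ, intervalIntegral.integral_const,
        intervalIntegral.integral_const_mul]
      simp only [sub_zero, smul_eq_mul]
      ring
    have hTb : (∫ x in X..lam, |deriv f x - h' x| * (1 + x))
        ≤ ∫ x in X..lam, (|deriv f x| * (1 + x) + |h' x| * (1 + x)) := by
      refine intervalIntegral.integral_mono_on hXl iT
        ((idXl.abs.mul_continuousOn (by fun_prop)).add (hk.intervalIntegrable _ _)) ?_
      intro x hx
      have hx1 : 0 ≤ 1 + x := by linarith [hx.1, hX]
      have := mul_le_mul_of_nonneg_right (abs_sub (deriv f x) (h' x)) hx1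
      linarith
    have hTe : (∫ x in X..lam, (|deriv f x| * (1 + x) + |h' x| * (1 + x)))
        = (∫ x in X..lam, |deriv f x| * (1 + x)) + ∫ x in X..lam, |h' x| * (1 + x) :=
      intervalIntegral.integral_add (idXl.abs.mul_continuousOn (by fun_prop))
        (hk.intervalIntegrable _ _)
    have hctX : c * t * (1 + X) * X ≤ 3 / 2 * ω := by
      have e : c * t * (1 + X) * X = c * (X * (1 + X) * t) := by ring
      have m := mul_le_mul_of_nonneg_left hXt hc0.le
      linarith only [e, m, hcω']
    have hγL : γ * (∫ x in (0 : ℝ)..X, |h' x| * (1 + x)) ≤ γ * L' :=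
      mul_le_mul_of_nonneg_left hL'X hγ0
    have eγ : γ * L' = 4 * (2 * H + 3) * L' * ω := by rw [hγdef]; ring
    linarith only [hWb, hWe, hTb, hTe, hctX, hγL, eγ, hTf', hω5, hω0]
  exact ⟨hE, hI1, hI3⟩

end IsProlateFunction

/-- Monotone-limit bound: `∫_0^X g ≤ lim_{Y→∞} ∫_0^Y g` for `g ≥ 0` on `[0, ∞)`. [folklore] -/
theorem integral_le_of_tendsto_of_nonneg {g : ℝ → ℝ} (hg : Continuous g)
    (hg0 : ∀ x, 0 ≤ x → 0 ≤ g x) {Lg : ℝ}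
    (hT : Tendsto (fun X ↦ ∫ x in (0 : ℝ)..X, g x) atTop (𝓝 Lg)) {X : ℝ} (hX : 0 ≤ X) :
    (∫ x in (0 : ℝ)..X, g x) ≤ Lg := by
  refine ge_of_tendsto hT ?_
  filter_upwards [eventually_ge_atTop X] with Y hY
  exact intervalIntegral.integral_mono_interval le_rfl hX hY
    (ae_restrict_of_forall_mem measurableSet_Ioc fun x hx ↦ hg0 x hx.1.le)
    (hg.intervalIntegrable _ _)

/-- Tail bound from the monotone limit: if `lim − ω ≤ ∫_0^X g` then `∫_X^λ g ≤ ω` (`g ≥ 0` on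
`[0, ∞)`, `0 ≤ X ≤ λ`). [folklore] -/
theorem integral_tail_le_of_tendsto {g : ℝ → ℝ} (hg : Continuous g)
    (hg0 : ∀ x, 0 ≤ x → 0 ≤ g x) {Lg : ℝ}
    (hT : Tendsto (fun X ↦ ∫ x in (0 : ℝ)..X, g x) atTop (𝓝 Lg)) {X lam ω : ℝ} (hX : 0 ≤ X)
    (hXl : X ≤ lam) (hω : Lg - ω ≤ ∫ x in (0 : ℝ)..X, g x) :
    (∫ x in X..lam, g x) ≤ ω := by
  have h1 := integral_le_of_tendsto_of_nonneg hg hg0 hT (hX.trans hXl)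
  have e : (∫ x in X..lam, g x) = (∫ x in (0 : ℝ)..lam, g x) - ∫ x in (0 : ℝ)..X, g x :=
    (intervalIntegral.integral_interval_sub_left (hg.intervalIntegrable _ _)
      (hg.intervalIntegrable _ _)).symm
  linarith

namespace IsProlateFunction

set_option maxHeartbeats 800000 in
/-- **Uniform limits from eigenvalue pinning.**  If the eigenvalues of the prolate functions with
`n` zeros are pinned, `χ/λ² → μ` uniformly (`hP`), and `h` solves the Hermite equation
`h'' = (4π²x² − μ)h` with `h(0) > 0`, `h′(0) = 0`, `|h| ≤ H`, `x h(x) → 0`, `h′ → 0`,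
`∫_0^X h² → 1/2`, `∫_0^X |h| → L`, `∫_0^X |h′|(1+x) → L′`, then uniformly over the prolate
functions `f` with `n` zeros: `λ|f(λ)| → 0`, `∫_0^λ |f − h| → 0`, `∫_0^λ |f′ − h′|(1+x) → 0`.
[cite: SlepianPollak1961, §III; Connes2026Letter, §6.3; folklore (Gronwall)] -/
theorem uniform_limits {n : ℕ} {μ : ℝ} (hμ : 1 ≤ μ)
    (hP : ∀ δ : ℝ, 0 < δ → ∃ Λ : ℝ, ∀ lam : ℝ, Λ ≤ lam → ∀ f : ℝ → ℝ, ∀ χ : ℝ,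
      IsProlateFunction lam n f →
      (∀ x ∈ Ioo (-lam) lam,
        -(deriv (fun y ↦ (lam ^ 2 - y ^ 2) * deriv f y) x) + (2 * π * lam * x) ^ 2 * f x
          = χ * f x) → |χ / lam ^ 2 - μ| ≤ δ)
    {h h' : ℝ → ℝ} (hh : ∀ x, HasDerivAt h (h' x) x)
    (hh' : ∀ x, HasDerivAt h' ((4 * π ^ 2 * x ^ 2 - μ) * h x) x)
    (hh0 : 0 < h 0) (hh'0 : h' 0 = 0) {H : ℝ} (hH : ∀ x, |h x| ≤ H)
    (hd : Tendsto (fun x ↦ x * h x) atTop (𝓝 0)) (hd' : Tendsto h' atTop (𝓝 0))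
    (hI : Tendsto (fun X ↦ ∫ x in (0 : ℝ)..X, h x ^ 2) atTop (𝓝 (1 / 2)))
    {L L' : ℝ} (hL : Tendsto (fun X ↦ ∫ x in (0 : ℝ)..X, |h x|) atTop (𝓝 L))
    (hL' : Tendsto (fun X ↦ ∫ x in (0 : ℝ)..X, |h' x| * (1 + x)) atTop (𝓝 L')) :
    ∀ ε : ℝ, 0 < ε → ∃ Λ : ℝ, ∀ lam : ℝ, Λ ≤ lam → ∀ f : ℝ → ℝ, IsProlateFunction lam n f →
      lam * |f lam| ≤ ε ∧ (∫ x in (0 : ℝ)..lam, |f x - h x|) ≤ ε ∧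
      (∫ x in (0 : ℝ)..lam, |deriv f x - h' x| * (1 + x)) ≤ ε := by
  intro ε hε
  have hhc : Continuous h := continuous_iff_continuousAt.2 fun y ↦ (hh y).continuousAt
  have hh'c : Continuous h' := continuous_iff_continuousAt.2 fun y ↦ (hh' y).continuousAt
  have hgc : Continuous fun x ↦ |h x| := hhc.abs
  have hkc : Continuous fun x ↦ |h' x| * (1 + x) := hh'c.abs.mul (by fun_prop)
  have hg0 : ∀ x : ℝ, 0 ≤ x → 0 ≤ |h x| := fun x _ ↦ abs_nonneg _
  have hk0 : ∀ x : ℝ, 0 ≤ x → 0 ≤ |h' x| * (1 + x) := fun x hx ↦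
    mul_nonneg (abs_nonneg _) (by linarith)
  have hH0 : 0 ≤ H := (abs_nonneg _).trans (hH 0)
  have hL0 : 0 ≤ L := by
    have := integral_le_of_tendsto_of_nonneg hgc hg0 hL le_rfl
    simpa using this
  have hL'0 : 0 ≤ L' := by
    have := integral_le_of_tendsto_of_nonneg hkc hk0 hL' le_rfl
    simpa using this
  -- the constants and the small parameter `ω`
  obtain ⟨M, hM0, hM1, hM2, hM3⟩ : ∃ M : ℝ, 0 < M ∧ 6 ≤ M ∧ 6 + 4 * (2 * H + 3) * L ≤ M ∧
      21 + 4 * (2 * H + 3) * L' ≤ M := by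
    have a : 0 ≤ (2 * H + 3) * L := by positivity
    have b : 0 ≤ (2 * H + 3) * L' := by positivity
    exact ⟨21 + 4 * (2 * H + 3) * (L + L'), by nlinarith, by nlinarith, by nlinarith, by nlinarith⟩
  obtain ⟨ω, hω0, hωs, hωM⟩ : ∃ ω : ℝ, 0 < ω ∧ 8 * (2 * H + 3) * ω ≤ 1 ∧ M * ω ≤ ε := by
    refine ⟨min (1 / (8 * (2 * H + 3))) (ε / M), lt_min (by positivity) (by positivity), ?_, ?_⟩
    · have h1 : min (1 / (8 * (2 * H + 3))) (ε / M) ≤ 1 / (8 * (2 * H + 3)) := min_le_left _ _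
      rwa [le_div_iff₀ (by positivity), mul_comm] at h1
    · have h1 : min (1 / (8 * (2 * H + 3))) (ε / M) ≤ ε / M := min_le_right _ _
      rwa [le_div_iff₀ hM0, mul_comm] at h1
  -- choice of the window `X`
  have C1 : ∀ᶠ X : ℝ in atTop, 2 ≤ X := eventually_ge_atTop 2
  have C2 : ∀ᶠ X : ℝ in atTop, μ + 2 ≤ X := eventually_ge_atTop (μ + 2)
  have C3 : ∀ᶠ X : ℝ in atTop, |X * h X| < ω / 2 := by
    have := Metric.tendsto_nhds.1 hd (ω / 2) (by positivity)
    simpa only [Real.dist_eq, sub_zero] using this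
  have C4 : ∀ᶠ X : ℝ in atTop, |h' X| < ω := by
    have := Metric.tendsto_nhds.1 hd' ω hω0
    simpa only [Real.dist_eq, sub_zero] using this
  have C5 : ∀ᶠ X : ℝ in atTop, |(∫ x in (0 : ℝ)..X, h x ^ 2) - 1 / 2| < ω := by
    have := Metric.tendsto_nhds.1 hI ω hω0
    simpa only [Real.dist_eq] using this
  have C6 : ∀ᶠ X : ℝ in atTop, |(∫ x in (0 : ℝ)..X, |h x|) - L| < ω := by
    have := Metric.tendsto_nhds.1 hL ω hω0
    simpa only [Real.dist_eq] using this
  have C7 : ∀ᶠ X : ℝ in atTop, |(∫ x in (0 : ℝ)..X, |h' x| * (1 + x)) - L'| < ω := by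
    have := Metric.tendsto_nhds.1 hL' ω hω0
    simpa only [Real.dist_eq] using this
  obtain ⟨X, hX2, hXμ, hX3, hX4, hX5, hX6, hX7⟩ :=
    (C1.and (C2.and (C3.and (C4.and (C5.and (C6.and C7)))))).exists
  have hX : 0 ≤ X := by linarith
  have hX1 : 1 ≤ X := by linarith
  -- window constants
  have hE0 : 0 < Real.exp (8 * (4 * π ^ 2 * X ^ 2 + μ + 2) * X) := Real.exp_pos _
  have hCx0 : 0 ≤ 2 * X + 4 * π ^ 2 * X ^ 4 + μ * X ^ 2 := by positivity
  have hXX : 1 ≤ X * (1 + X) := by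
    have := mul_le_mul hX1 (by linarith : (1 : ℝ) ≤ 1 + X) zero_le_one hX
    linarith
  obtain ⟨t, ht0, hXt, htω⟩ : ∃ t : ℝ, 0 < t ∧ X * (1 + X) * t ≤ ω ∧ t ≤ ω := by
    refine ⟨ω / (X * (1 + X)), by positivity, ?_, div_le_self hω0.le hXX⟩
    rw [mul_div_cancel₀ _ (by positivity : X * (1 + X) ≠ 0)]
  obtain ⟨δ, hδ0, hδ12, hδt⟩ : ∃ δ : ℝ, 0 < δ ∧ δ ≤ 1 / 2 ∧
      4 * h 0 * Real.exp (8 * (4 * π ^ 2 * X ^ 2 + μ + 2) * X) * δ ≤ t := by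
    refine ⟨min (1 / 2) (t / (4 * h 0 * Real.exp (8 * (4 * π ^ 2 * X ^ 2 + μ + 2) * X))),
      lt_min (by norm_num) (by positivity), min_le_left _ _, ?_⟩
    have h1 : min (1 / 2) (t / (4 * h 0 * Real.exp (8 * (4 * π ^ 2 * X ^ 2 + μ + 2) * X)))
        ≤ t / (4 * h 0 * Real.exp (8 * (4 * π ^ 2 * X ^ 2 + μ + 2) * X)) := min_le_right _ _
    rwa [le_div_iff₀ (by positivity), mul_comm] at h1
  -- eigenvalue pinning
  obtain ⟨Λ₁, hΛ₁⟩ := hP δ hδ0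
  refine ⟨max Λ₁ (max (2 * X + 2) ((2 * X + 4 * π ^ 2 * X ^ 4 + μ * X ^ 2) / δ + 1)),
    fun lam hlam f hf ↦ ?_⟩
  have hl1 : Λ₁ ≤ lam := (le_max_left _ _).trans hlam
  have hl2 : 2 * X + 2 ≤ lam := ((le_max_left _ _).trans (le_max_right _ _)).trans hlam
  have hl3 : (2 * X + 4 * π ^ 2 * X ^ 4 + μ * X ^ 2) / δ + 1 ≤ lam :=
    ((le_max_right _ _).trans (le_max_right _ _)).trans hlam
  have hlam0 : 0 < lam := hf.lam_pos
  have hlsq : 0 < lam ^ 2 := by positivity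
  obtain ⟨χ, hχ⟩ := hf.eigen
  have hpin := hΛ₁ lam hl1 f χ hf hχ
  have hχδ : |χ - μ * lam ^ 2| ≤ δ * lam ^ 2 := by
    have e : χ - μ * lam ^ 2 = (χ / lam ^ 2 - μ) * lam ^ 2 := by field_simp
    rw [e, abs_mul, abs_of_pos hlsq]
    exact mul_le_mul_of_nonneg_right hpin hlsq.le
  have hχ0 : 0 ≤ χ := by
    have h1 := (abs_le.1 hpin).1
    have h2 : 0 ≤ χ / lam ^ 2 := by linarith
    have e : χ = χ / lam ^ 2 * lam ^ 2 := by field_simp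
    rw [e]; positivity
  have hD : 1 ≤ 4 * π ^ 2 * X ^ 2 - μ - δ := by
    have hπ : 9 ≤ π ^ 2 := by nlinarith [Real.pi_gt_three]
    have h1 : X ≤ X ^ 2 := by nlinarith
    have h2 : 9 * X ^ 2 ≤ π ^ 2 * X ^ 2 := mul_le_mul_of_nonneg_right hπ (sq_nonneg X)
    linarith
  have hCxδ : (2 * X + 4 * π ^ 2 * X ^ 4 + μ * X ^ 2) / lam ^ 2 ≤ δ := by
    rw [div_le_iff₀ hlsq]
    have h1 : (2 * X + 4 * π ^ 2 * X ^ 4 + μ * X ^ 2) / δ ≤ lam - 1 := by linarith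
    have h2 := (div_le_iff₀ hδ0).1 h1
    have h3 : lam - 1 ≤ lam ^ 2 := by nlinarith
    have h4 := mul_le_mul_of_nonneg_left h3 hδ0.le
    linarith
  have hwin : h 0 * (2 * Real.exp (8 * (4 * π ^ 2 * X ^ 2 + μ + 2) * X) *
      (δ + (2 * X + 4 * π ^ 2 * X ^ 4 + μ * X ^ 2) / lam ^ 2)) ≤ t := by
    calc h 0 * (2 * Real.exp (8 * (4 * π ^ 2 * X ^ 2 + μ + 2) * X) *
          (δ + (2 * X + 4 * π ^ 2 * X ^ 4 + μ * X ^ 2) / lam ^ 2))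
        ≤ h 0 * (2 * Real.exp (8 * (4 * π ^ 2 * X ^ 2 + μ + 2) * X) * (δ + δ)) :=
          mul_le_mul_of_nonneg_left (mul_le_mul_of_nonneg_left (by linarith) (by positivity))
            hh0.le
      _ = 4 * h 0 * Real.exp (8 * (4 * π ^ 2 * X ^ 2 + μ + 2) * X) * δ := by ring
      _ ≤ t := hδt
  -- `ω`-conditions at `X`
  have hω1 : (1 + X) * |h X| ≤ ω := by
    have h1 : |X * h X| = X * |h X| := by rw [abs_mul, abs_of_nonneg hX]
    have h2 := mul_nonneg (by linarith : 0 ≤ X - 1) (abs_nonneg (h X))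
    linarith [hX3.le]
  have hω3 : |(∫ x in (0 : ℝ)..X, h x ^ 2) - 1 / 2| ≤ ω := hX5.le
  have hXl : X ≤ lam := by linarith
  have hω4 : (∫ x in X..lam, |h x|) ≤ ω :=
    integral_tail_le_of_tendsto hgc hg0 hL hX hXl (by have := (abs_lt.1 hX6).1; linarith)
  have hω5 : (∫ x in X..lam, |h' x| * (1 + x)) ≤ ω :=
    integral_tail_le_of_tendsto hkc hk0 hL' hX hXl (by have := (abs_lt.1 hX7).1; linarith)
  have hLX : (∫ x in (0 : ℝ)..X, |h x|) ≤ L := integral_le_of_tendsto_of_nonneg hgc hg0 hL hX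
  have hL'X : (∫ x in (0 : ℝ)..X, |h' x| * (1 + x)) ≤ L' :=
    integral_le_of_tendsto_of_nonneg hkc hk0 hL' hX
  obtain ⟨o1, o2, o3⟩ := hf.core_outputs hχ hX2 hμ hδ0.le (by linarith) hl2 hχ0 hχδ hD hh hh'
    hh0 hh'0 hH ht0.le htω hXt hωs hwin hω1 hX4.le hω3 hω4 hω5 hLX hL'X
  have hω0' := hω0.le
  have m1 : 6 * ω ≤ M * ω := mul_le_mul_of_nonneg_right hM1 hω0'
  have m2 : (6 + 4 * (2 * H + 3) * L) * ω ≤ M * ω := mul_le_mul_of_nonneg_right hM2 hω0'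
  have m3 : (21 + 4 * (2 * H + 3) * L') * ω ≤ M * ω := mul_le_mul_of_nonneg_right hM3 hω0'
  exact ⟨by linarith, by linarith, by linarith⟩

end IsProlateFunction

end Literature.NumberTheory.LFunctions
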